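import Literature.MathematicalPhysics.QuantumFieldTheory.Balaban1983to89.B11Thm1ExistsUniqueTokensGBBridges
import Summits.QuantumFields.YangMills.Theorems.BalabanUVNodesN07Thm1Top7FromProp8GuardedB
import Summits.QuantumFields.YangMills.Theorems.BalabanUVNodesN12Thm1NamesOfK0GridGStepTokens
import HarnessLib

/-!
# BalabanUVNodes ∕ N12 — THE (E∕U) NAME OF [15] THEOREM 1 AT K0⁷'s GRID GUARD OVER A BOND-LEVEL DETERMINING DATUM `(bd, Dat)`, FROM THE STEP ∕ SUPPLY ∕ LIFT TOKENS ᴮ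
# ([Balaban1985Variational] Thm 1 (8) p.279, (11)–(14) pp.279–280, Prop. 2 p.281; [Balaban1984PropagatorsII] (2.3) p.224; [Balaban1985RegularSpaces] (1.3)–(1.6) p.77; [Balaban1988Convergent] (2.12) p.256, (2.18) p.257)

Cell `pub-ymgap` (HUMAN RULINGS D-0062 ∕ D-0149), seat `pub-ymgap-dag-n12-d` g31 (R134 N12 [B15] s2 = by-name knit at the record; count-neutral helper of K1⁹ `stmt-QuantumFields-27364`,
`--kind proof --supports … --as helper`).  THEOREMS ONLY (0 `def`, 0 `instance`, 0 `sorry`); composition BY NAME.  THE PRINT-DATUM TWIN of §1–§2 of this seat's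
`…N12Thm1NamesOfK0GridGStepTokens` (chair #11063; INTENT-111 of 2026-08-30).

WHY ((E1) variant (iii-b) of director-ym №335–№346; FLAG №16 ∕ LOCATE-HSEAM 5d3298b8d191f169; this seat's N12 blast census `N12-STAGE2-BLAST-CENSUS-2026-08-30.md` efbc55e7aa2b3425 §(3)(ii)).
The record's determining-set datum was typed in reading (b) («bonds MEETING `Γ_j`», `B15DeterminingSets.bondsOf` :174); print's [II] (2.3) datum is the DIFFERENCE of the bond stars
(ruling (α), director-ym №339) and Stage 2 re-points the record's multi-scale background to it.  Every [15]-Theorem-1 name N12's 12Q-DIRECT road displays is therefore being re-typed over a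
bond-level datum `bd : Node00.BondDatum F` and a top-data predicate `Dat : Node00.TopData F N`: K0's S1a-C `Node00.VariationalThm1RegSepCoP7MGB` (the (R) half, ✓p766015) and dag-n12-c g34's
`B11Thm1ExistsUniqueTokensGB` ∕ `…TokensGBBridges` (the (E∕U) name, its one-length STEP, length-1 SUPPLY and LIFT tokens, and print's k-induction over `(bd, Dat)`).  N12's junctions at K0⁷'s
currency (L5 #10975, L6 #10981, L7 #10982) read both names at K0⁷'s REGISTERED GRID GUARD
`A‴(c,c₀,c₁) := fun ν M g K k _s => c ≤ ν.M₁ ∧ k + c₀ ≤ F.m + K ∧ F.L^{c₁} ∣ M ∧ ∀ i, 1 ≤ i → i ≤ k → dCubeSide (F.P K).L M (RkOfRecord (F.P K).L ν.r (g i)) i ∣ (F.P K).sitesPerDir 0`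
(quoted VERBATIM from `K0V22ZDefs.Prop8StepCoPGridGAt` :49–50; its truncation-stability lemma `gridGuard_of_succ` is IMPORTED from the (b)-file, so this file is red-by-CLOSURE during the Stage-2
window exactly like the (b)-file — green before and after, zero text change; the V22-Z stub texts stay the (b)-instance).  THIS
FILE is the grid-guard consumer of the tokens ᴮ: (E∕U)ᴮ at `A‴` from (R)ᴮ + STEPᴮ + SUPPLYᴮ(length 1) + LIFTᴮ, for ANY `(bd, Dat)` — in particular at print's datum
`(Node00.lamDatum F, Node00.dataSmall7LamTopOf F N)` and at the (b)-instance `(Node00.genSetDatum F, Node00.dataSmall7PTopOf F N)`, where it IS §2 of the (b)-file by dag-n12-c's `Iff.rfl`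
dictionary (§3 below checks this in kernel).  The third piece of the (b)-file — BOTH names from K0⁷'s stub-1 text — is §4, keyed on the BODY of the V23 stub-1 draft text at print's datum
(`K0AllTorusOfStepTokensGuardedZBLam`'s `h1G`, one `F`, generic `N` and `Dat`; `K0V23Defs` is not registered at the time of writing, so no def is imported or named) and on module 53′
`N07Thm1Top7FromProp8GuardedB.variationalThm1RegSepCoP7MGB_of_prop8TopStepGB_lamDatum` (k0-s1-w1, ✓p766180).

WHAT THIS FILE PROVES.  (§1 of the (b)-file, `gridGuard_of_succ` — `A‴(c,c₀,c₁)` is TRUNCATION-STABLE along print's induction, datum-free — is REUSED by import, not restated.)  §2 ★★ `variationalThm1EUSepCoP7MGB_grid_of_step_of_reg_of_base_of_lift`: for every `(bd, Dat)`, (R)ᴮ at `A‴` +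
STEPᴮ at `A‴` + SUPPLYᴮ at `A‴ ∧ k = 1` + LIFTᴮ at `A‴` ⊢ (E∕U)ᴮ at `A‴` — ONE application of dag-n12-c's ★★★ `variationalThm1EUSepCoP7MGB_of_step_of_reg_of_base_of_lift` with §1 as
its truncation row (generic `N`); `…Top7MGB…` edition alongside (any top support `Sup`).  §3 `…_grid_genSetDatum_iff`: at the (b)-instance the conclusion of §2 IS the conclusion of the
(b)-file's §2 (`Iff.rfl` through `variationalThm1EUSepCoP7MG_iff_GB`) — the kernel check that the twin specialises to the landed sentence.  §4 ★★★ `thm1NamesB_grid_lamDatum_of_prop8StepGB_of_stepTokensB`: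
AT PRINT's DATUM `lamDatum F` (any data predicate `Dat`, generic `N`), from the V23-draft stub-1 BODY `∃ (c c₀ c₁) (B₃ a₀ a₁), 2L² ≤ B₃ ∧ 0 < a₀ ∧ 0 < a₁ ∧ Prop8RegSepTopStepGB F N suppDom A‴ (lamDatum F) Dat B₃ a₀ a₁`
ALONE: ∃ the constants with the (R)ᴮ-name at `A‴` (module 53′) AND, for every `C₁`, STEPᴮ → SUPPLYᴮ → LIFTᴮ → the (E∕U)ᴮ-name at `A‴` (§2) — the print-datum twin of the (b)-file's §3.

HONEST FRAMING.  By-name composition; the four tokens ᴮ have NO producer at any datum («INHABITED BY»: nobody) — everything CONDITIONAL; the (b)-file #11063 stays landed and true on its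
own text (honesty guard №338 (5): nothing edited, deleted or weakened; this file is NEW); no stub text is touched (K0⁷'s V22-Z texts stay registered; `stmt-QuantumFields-20541` OPEN);
nothing of Bałaban's asserted; N12 NOT discharged — and after Stage 2 its junction of record speaks of the (b)-background until the road is re-keyed (census §(3)); K0⁷ ∕ K1⁹ OPEN; counts
unmoved (typed 28∕28 · discharged 8∕28, 8∕27 excl. NODE O); one finite 𝕋⁴ programme at fixed `ε = L^{-K}` — R4 closes only the conditional rung `BalabanLadder.UV`; nothing continuum ∕ ℝ⁴ ∕
OS; the Yang–Mills mass gap (Clay) is NOT proved by any of this.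
-/

noncomputable section

namespace Summit.QuantumFields.YangMills.BalabanUVNodes.N12Thm1NamesOfGridGStepTokensB

open Literature.MathematicalPhysics.QuantumFieldTheory.Balaban1983to89
open Literature.MathematicalPhysics.QuantumFieldTheory.Balaban1983to89.Node00
open Literature.MathematicalPhysics.QuantumFieldTheory.Balaban1983to89.T4Continuum
open Summit.QuantumFields.YangMills.BalabanUVNodes.N07Thm1Top7FromProp8GuardedB (variationalThm1RegSepCoP7MGB_of_prop8TopStepGB_lamDatum)
open Summit.QuantumFields.YangMills.BalabanUVNodes.N12Thm1NamesOfK0GridGStepTokens (gridGuard_of_succ)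
open B11Thm1ExistsUniqueInductionG (truncSeq)
open B11Thm1ExistsUniqueTokensGB (VariationalThm1EUSepTop7MGB VariationalThm1EUSepCoP7MGB VariationalThm1EUStepTop7MGB VariationalThm1EUStepCoP7MGB
  ApproxMinimiserExistsTop7MGB ApproxMinimiserExistsCoP7MGB VariationalThm1EULiftTop7MGB VariationalThm1EULiftCoP7MGB
  variationalThm1EUSepTop7MGB_of_step_of_reg_of_base_of_lift variationalThm1EUSepCoP7MGB_of_step_of_reg_of_base_of_lift variationalThm1EUSepCoP7MG_iff_GB)

variable {F : T4Family}

/-! ## §2  The induction over `(bd, Dat)` at `Adm := A‴`: (R)ᴮ + STEPᴮ ∕ SUPPLYᴮ ∕ LIFTᴮ ⊢ (E∕U)ᴮ, the truncation row supplied by §1 -/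

/-- ★★ **(E∕U)ᴮ AT K0⁷'s GRID GUARD FROM (R)ᴮ + THE THREE TOKENS ᴮ, TOP-SUPPORT EDITION** (any top support `Sup`, any bond datum `bd`, any data predicate `Dat`, generic `N`):
dag-n12-c g34's k-induction `variationalThm1EUSepTop7MGB_of_step_of_reg_of_base_of_lift` at `Adm := A‴(c,c₀,c₁)`, its truncation-stability row discharged by §1.  CONDITIONAL (no
producer for any token at any datum). [cite: Balaban1985Variational, Thm 1 p.279, (11)–(14) pp.279–280, Prop. 2 p.281; Balaban1984PropagatorsII, (2.3) p.224; Balaban1988Convergent, (2.12) p.256, (2.18) p.257] -/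
theorem variationalThm1EUSepTop7MGB_grid_of_step_of_reg_of_base_of_lift {N : ℕ} [NeZero N] (c c₀ c₁ : ℕ)
    {Sup : (ν : Stage7Numerics) → (K : ℕ) → (ℕ → Set (Site (F.P K) 0)) → Set (Site (F.P K) 0)} {bd : BondDatum F} {Dat : TopData F N} {C₁ B₃ a₀ a₁ : ℝ}
    (hstep : VariationalThm1EUStepTop7MGB F N Sup
      (fun ν M g K k _s => c ≤ ν.M₁ ∧ k + c₀ ≤ F.m + K ∧ F.L ^ c₁ ∣ M ∧
        ∀ i, 1 ≤ i → i ≤ k → dCubeSide (F.P K).L M (RkOfRecord (F.P K).L ν.r (g i)) i ∣ (F.P K).sitesPerDir 0) bd Dat C₁ B₃ a₀ a₁)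
    (hR : VariationalThm1RegSepTop7MGB F N Sup
      (fun ν M g K k _s => c ≤ ν.M₁ ∧ k + c₀ ≤ F.m + K ∧ F.L ^ c₁ ∣ M ∧
        ∀ i, 1 ≤ i → i ≤ k → dCubeSide (F.P K).L M (RkOfRecord (F.P K).L ν.r (g i)) i ∣ (F.P K).sitesPerDir 0) bd Dat B₃ a₀ a₁)
    (hbase : ApproxMinimiserExistsTop7MGB F N Sup
      (fun ν M g K k _s => (c ≤ ν.M₁ ∧ k + c₀ ≤ F.m + K ∧ F.L ^ c₁ ∣ M ∧
        ∀ i, 1 ≤ i → i ≤ k → dCubeSide (F.P K).L M (RkOfRecord (F.P K).L ν.r (g i)) i ∣ (F.P K).sitesPerDir 0) ∧ k = 1) bd Dat C₁ B₃ a₀ a₁)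
    (hlift : VariationalThm1EULiftTop7MGB F N Sup
      (fun ν M g K k _s => c ≤ ν.M₁ ∧ k + c₀ ≤ F.m + K ∧ F.L ^ c₁ ∣ M ∧
        ∀ i, 1 ≤ i → i ≤ k → dCubeSide (F.P K).L M (RkOfRecord (F.P K).L ν.r (g i)) i ∣ (F.P K).sitesPerDir 0) bd Dat C₁ B₃ a₀ a₁) :
    VariationalThm1EUSepTop7MGB F N Sup
      (fun ν M g K k _s => c ≤ ν.M₁ ∧ k + c₀ ≤ F.m + K ∧ F.L ^ c₁ ∣ M ∧
        ∀ i, 1 ≤ i → i ≤ k → dCubeSide (F.P K).L M (RkOfRecord (F.P K).L ν.r (g i)) i ∣ (F.P K).sitesPerDir 0) bd Dat B₃ a₀ a₁ :=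
  variationalThm1EUSepTop7MGB_of_step_of_reg_of_base_of_lift hstep hR hbase hlift
    fun ν M g K k _s _ h => gridGuard_of_succ (F := F) c c₀ c₁ ν M g K k h

/-- ★★ **(E∕U)ᴮ AT K0⁷'s GRID GUARD FROM (R)ᴮ + THE THREE TOKENS ᴮ, ON THE SUPPORT OF RECORD** (`CoP` editions; any `(bd, Dat)`, generic `N`) — the print-datum twin of the (b)-file's
§2 `variationalThm1EUSepCoP7MG_grid_of_step_of_reg_of_base_of_lift`: dag-n12-c g34's `variationalThm1EUSepCoP7MGB_of_step_of_reg_of_base_of_lift` at `Adm := A‴(c,c₀,c₁)` with §1.  At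
`(bd, Dat) := (Node00.lamDatum F, Node00.dataSmall7LamTopOf F N)` this is the sentence at PRINT's [II] (2.3) datum (ruling (α)); at `(Node00.genSetDatum F, Node00.dataSmall7PTopOf F N)` it is the
landed (b)-sentence (§3).  CONDITIONAL (no producer for any token). [cite: Balaban1985Variational, Thm 1 p.279, (11)–(14) pp.279–280, Prop. 2 p.281; Balaban1984PropagatorsII, (2.3) p.224; Balaban1988Convergent, (2.12) p.256, (2.18) p.257] -/
theorem variationalThm1EUSepCoP7MGB_grid_of_step_of_reg_of_base_of_lift {N : ℕ} [NeZero N] (c c₀ c₁ : ℕ) {bd : BondDatum F} {Dat : TopData F N} {C₁ B₃ a₀ a₁ : ℝ}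
    (hstep : VariationalThm1EUStepCoP7MGB F N
      (fun ν M g K k _s => c ≤ ν.M₁ ∧ k + c₀ ≤ F.m + K ∧ F.L ^ c₁ ∣ M ∧
        ∀ i, 1 ≤ i → i ≤ k → dCubeSide (F.P K).L M (RkOfRecord (F.P K).L ν.r (g i)) i ∣ (F.P K).sitesPerDir 0) bd Dat C₁ B₃ a₀ a₁)
    (hR : VariationalThm1RegSepCoP7MGB F N
      (fun ν M g K k _s => c ≤ ν.M₁ ∧ k + c₀ ≤ F.m + K ∧ F.L ^ c₁ ∣ M ∧
        ∀ i, 1 ≤ i → i ≤ k → dCubeSide (F.P K).L M (RkOfRecord (F.P K).L ν.r (g i)) i ∣ (F.P K).sitesPerDir 0) bd Dat B₃ a₀ a₁)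
    (hbase : ApproxMinimiserExistsCoP7MGB F N
      (fun ν M g K k _s => (c ≤ ν.M₁ ∧ k + c₀ ≤ F.m + K ∧ F.L ^ c₁ ∣ M ∧
        ∀ i, 1 ≤ i → i ≤ k → dCubeSide (F.P K).L M (RkOfRecord (F.P K).L ν.r (g i)) i ∣ (F.P K).sitesPerDir 0) ∧ k = 1) bd Dat C₁ B₃ a₀ a₁)
    (hlift : VariationalThm1EULiftCoP7MGB F N
      (fun ν M g K k _s => c ≤ ν.M₁ ∧ k + c₀ ≤ F.m + K ∧ F.L ^ c₁ ∣ M ∧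
        ∀ i, 1 ≤ i → i ≤ k → dCubeSide (F.P K).L M (RkOfRecord (F.P K).L ν.r (g i)) i ∣ (F.P K).sitesPerDir 0) bd Dat C₁ B₃ a₀ a₁) :
    VariationalThm1EUSepCoP7MGB F N
      (fun ν M g K k _s => c ≤ ν.M₁ ∧ k + c₀ ≤ F.m + K ∧ F.L ^ c₁ ∣ M ∧
        ∀ i, 1 ≤ i → i ≤ k → dCubeSide (F.P K).L M (RkOfRecord (F.P K).L ν.r (g i)) i ∣ (F.P K).sitesPerDir 0) bd Dat B₃ a₀ a₁ :=
  variationalThm1EUSepCoP7MGB_of_step_of_reg_of_base_of_lift hstep hR hbase hlift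
    fun ν M g K k _s _ h => gridGuard_of_succ (F := F) c c₀ c₁ ν M g K k h

/-! ## §3  The (b)-instance of §2's conclusion IS the landed (b)-sentence at `A‴` -/

/-- **KERNEL CHECK OF THE TWIN**: at the (b)-instance `(Node00.genSetDatum F, Node00.dataSmall7PTopOf F N)` the conclusion of §2 IS the (b)-file's conclusion
`B11Thm1ExistsUniqueCoP7MG.VariationalThm1EUSepCoP7MG F N A‴ B₃ a₀ a₁` (the name N12's L5∕L7 display as `hEUG`), definitionally — dag-n12-c's `variationalThm1EUSepCoP7MG_iff_GB` read at the
grid guard. [cite: Balaban1985Variational, Thm 1 p.279; Balaban1988Convergent, (2.10)–(2.12) p.256; Balaban1987RG1, (0.1) p.251] -/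
theorem variationalThm1EUSepCoP7MGB_grid_genSetDatum_iff {N : ℕ} [NeZero N] (c c₀ c₁ : ℕ) {B₃ a₀ a₁ : ℝ} :
    VariationalThm1EUSepCoP7MGB F N
        (fun ν M g K k _s => c ≤ ν.M₁ ∧ k + c₀ ≤ F.m + K ∧ F.L ^ c₁ ∣ M ∧
          ∀ i, 1 ≤ i → i ≤ k → dCubeSide (F.P K).L M (RkOfRecord (F.P K).L ν.r (g i)) i ∣ (F.P K).sitesPerDir 0) (genSetDatum F) (dataSmall7PTopOf F N) B₃ a₀ a₁ ↔
      B11Thm1ExistsUniqueCoP7MG.VariationalThm1EUSepCoP7MG F N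
        (fun ν M g K k _s => c ≤ ν.M₁ ∧ k + c₀ ≤ F.m + K ∧ F.L ^ c₁ ∣ M ∧
          ∀ i, 1 ≤ i → i ≤ k → dCubeSide (F.P K).L M (RkOfRecord (F.P K).L ν.r (g i)) i ∣ (F.P K).sitesPerDir 0) B₃ a₀ a₁ :=
  variationalThm1EUSepCoP7MG_iff_GB.symm

/-! ## §4  Both names at K0⁷'s grid guard AT PRINT's DATUM from the V23-draft stub-1 body + the three tokens ᴮ -/

/-- ★★★ **BOTH [15]-THEOREM-1 NAMES ᴮ AT K0⁷'s GRID GUARD, AT PRINT's [II] (2.3) DATUM `lamDatum F`, FROM THE STUB-1 BODY + STEPᴮ ∕ SUPPLYᴮ ∕ LIFTᴮ** (any data predicate `Dat`, generic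
`N`).  From the BODY of the V23-draft stub-1 text at one `F` (`K0AllTorusOfStepTokensGuardedZBLam`'s `h1G`; no `K0V23Defs` name is used — none is registered yet): ∃ the stub's constants
`(c, c₀, c₁, B₃, a₀, a₁)` with `2L² ≤ B₃`, `0 < a₀`, `0 < a₁`, the (R)ᴮ-name `Node00.VariationalThm1RegSepCoP7MGB F N A‴ (lamDatum F) Dat B₃ a₀ a₁` (module 53′
`variationalThm1RegSepCoP7MGB_of_prop8TopStepGB_lamDatum`, k0-s1-w1) — AND, for every `C₁`, STEPᴮ → SUPPLYᴮ(length 1) → LIFTᴮ → the (E∕U)ᴮ-name at `A‴` (§2).  The print-datum twin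
of the (b)-file's §3 `thm1Names_grid_of_prop8StepCoPGridGAt_of_stepTokens`; CONDITIONAL (stub 1 OPEN at every datum; no token producer).
[cite: Balaban1985Variational, Thm 1 (8) p.279, (11)–(14) pp.279–280, Prop. 2 p.281, Prop. 8 p.304; Balaban1984PropagatorsII, (2.3) p.224; Balaban1985RegularSpaces, (1.3)–(1.6) p.77; Balaban1988Convergent, (2.12) p.256, (2.18) p.257] -/
theorem thm1NamesB_grid_lamDatum_of_prop8StepGB_of_stepTokensB {N : ℕ} [NeZero N] {Dat : TopData F N}
    (h1 : ∃ (c c₀ c₁ : ℕ) (B₃ a₀ a₁ : ℝ), 2 * (F.L : ℝ) ^ 2 ≤ B₃ ∧ 0 < a₀ ∧ 0 < a₁ ∧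
      Prop8RegSepTopStepGB F N (fun ν K Ω => suppDomOfRecord F ν K Ω)
        (fun ν M g K k _s => c ≤ ν.M₁ ∧ k + c₀ ≤ F.m + K ∧ F.L ^ c₁ ∣ M ∧
          ∀ i, 1 ≤ i → i ≤ k → dCubeSide (F.P K).L M (RkOfRecord (F.P K).L ν.r (g i)) i ∣ (F.P K).sitesPerDir 0) (lamDatum F) Dat B₃ a₀ a₁) :
    ∃ (c c₀ c₁ : ℕ) (B₃ a₀ a₁ : ℝ), 2 * (F.L : ℝ) ^ 2 ≤ B₃ ∧ 0 < a₀ ∧ 0 < a₁ ∧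
      VariationalThm1RegSepCoP7MGB F N
        (fun ν M g K k _s => c ≤ ν.M₁ ∧ k + c₀ ≤ F.m + K ∧ F.L ^ c₁ ∣ M ∧
          ∀ i, 1 ≤ i → i ≤ k → dCubeSide (F.P K).L M (RkOfRecord (F.P K).L ν.r (g i)) i ∣ (F.P K).sitesPerDir 0) (lamDatum F) Dat B₃ a₀ a₁ ∧
      ∀ C₁ : ℝ,
        VariationalThm1EUStepCoP7MGB F N
          (fun ν M g K k _s => c ≤ ν.M₁ ∧ k + c₀ ≤ F.m + K ∧ F.L ^ c₁ ∣ M ∧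
            ∀ i, 1 ≤ i → i ≤ k → dCubeSide (F.P K).L M (RkOfRecord (F.P K).L ν.r (g i)) i ∣ (F.P K).sitesPerDir 0) (lamDatum F) Dat C₁ B₃ a₀ a₁ →
        ApproxMinimiserExistsCoP7MGB F N
          (fun ν M g K k _s => (c ≤ ν.M₁ ∧ k + c₀ ≤ F.m + K ∧ F.L ^ c₁ ∣ M ∧
            ∀ i, 1 ≤ i → i ≤ k → dCubeSide (F.P K).L M (RkOfRecord (F.P K).L ν.r (g i)) i ∣ (F.P K).sitesPerDir 0) ∧ k = 1) (lamDatum F) Dat C₁ B₃ a₀ a₁ →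
        VariationalThm1EULiftCoP7MGB F N
          (fun ν M g K k _s => c ≤ ν.M₁ ∧ k + c₀ ≤ F.m + K ∧ F.L ^ c₁ ∣ M ∧
            ∀ i, 1 ≤ i → i ≤ k → dCubeSide (F.P K).L M (RkOfRecord (F.P K).L ν.r (g i)) i ∣ (F.P K).sitesPerDir 0) (lamDatum F) Dat C₁ B₃ a₀ a₁ →
        VariationalThm1EUSepCoP7MGB F N
          (fun ν M g K k _s => c ≤ ν.M₁ ∧ k + c₀ ≤ F.m + K ∧ F.L ^ c₁ ∣ M ∧
            ∀ i, 1 ≤ i → i ≤ k → dCubeSide (F.P K).L M (RkOfRecord (F.P K).L ν.r (g i)) i ∣ (F.P K).sitesPerDir 0) (lamDatum F) Dat B₃ a₀ a₁ := by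
  obtain ⟨c, c₀, c₁, B₃, a₀, a₁, hB₃, ha₀, ha₁, h8⟩ := h1
  have hL : (0 : ℝ) < F.L := by exact_mod_cast (show 0 < F.L by have := F.hL.2; omega)
  have hB : 0 < B₃ := lt_of_lt_of_le (by positivity) hB₃
  have hR := variationalThm1RegSepCoP7MGB_of_prop8TopStepGB_lamDatum hB h8
  exact ⟨c, c₀, c₁, B₃, a₀, a₁, hB₃, ha₀, ha₁, hR, fun C₁ hstep hbase hlift =>
    variationalThm1EUSepCoP7MGB_grid_of_step_of_reg_of_base_of_lift c c₀ c₁ hstep hR hbase hlift⟩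

end Summit.QuantumFields.YangMills.BalabanUVNodes.N12Thm1NamesOfGridGStepTokensB

end
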